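import Summits.QuantumFields.YangMills.Theorems.BalabanUVNodesN18CombStepC1Sum
import HarnessLib

/-!
# BalabanUVNodes ∕ node N18 = NE5 — closure-ledger item (iii), comb step M4c, file (6d-pre):
# THE TWO INTERNAL LETTERS OF (4c)/(4d) EXPOSED — THE BASE CHANGE OF THE TRANSPORTED COMB (`69ℓ²ta`) AND THE MAIN BLOCK OF THE C¹ CANCELLED SUM

(Track A, DAG node N18 = `T4OutputRate.NE5`; cluster K4 «SpineRates», key item K3⁸ `SpineGivenEndpointR13SepCoPHV` (stmt-QuantumFields-27366);
seat pub-ymgap-dag-n18-w3 g5, INTENT-6 = design step M4c of `COMB-STEP-DESIGN.md` ∕ `COMB-CHAIN-INDEX.md`.)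

HONEST FRAMING.  Count-neutral kernel bookkeeping (`--supports stmt-QuantumFields-27366 --as helper`).  The sharp C¹ cancelled sum (M4c, file (6d)
`…CombStepC1SumSharp`) splits `W = M + Rem₁ + (η∕ξ)·BC` at both bonds and needs the bounds of the transported main block `M` and of the base-change
term `BC` SEPARATELY; in (4c) `norm_transported_comb_sub_main_le` and (4d) `norm_nabla_transported_comb_le` they are internal `have`s.  This file
re-proves them verbatim as standalone theorems (same hypotheses, same constants): ★ `norm_transported_comb_sub_combMean_le`
(`‖U_A(c)·m(c₊)·U_A(c)⁻¹ − λ̄_{Ad(v)A′}(c₊)‖ ≤ 69ℓ²ta`) and ★ `norm_transported_main_sub_main_le`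
(`‖Ū(U)(y,ν)·M(c′)·Ū(U)(y,ν)⁻¹ − M(c)‖ ≤ (η∕ξ)L(69ℓta + L(ηa₁ + 2ta))`).  No new mathematics.  Nothing of Bałaban's analysis is asserted beyond
the cited tree theorems; NE5 NOT printed ∕ NOT proved; N18 NOT discharged; finite tori — nothing about the continuum ∕ OS ∕ mass gap; YM mass gap
(Clay) NOT proved — R4 closes the conditional finite-𝕋⁴ rung `BalabanLadder.UV` only.

0 `def`, 0 `sorry`.  References: T. Bałaban, CMP **98** (1985) 17–51 [Balaban1985Averaging] (Prop. 3 (122)–(126) p.36, (62)–(63) p.28, pp.24–25);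
CMP **109** (1987) 249–301 [Balaban1987RG1] ((0.4) p.253, (1.10)–(1.13) p.262); Propagators I [Balaban1984PropagatorsI] ((1.11) p.19).
-/

noncomputable section

open scoped BigOperators Matrix.Norms.L2Operator
open NormedSpace

namespace YMDAG.N18.TransportOfRecord

open Complex (I)
open Literature.MathematicalPhysics.QuantumFieldTheory.Balaban1983to89
open Literature.MathematicalPhysics.QuantumFieldTheory.Balaban1983to89.T4Continuum
open Literature.MathematicalPhysics.QuantumFieldTheory.Balaban1983to89.BlockAveraging
open Literature.MathematicalPhysics.QuantumFieldTheory.Balaban1983to89.BlockAveragingEMLLinearised (combMean)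
open Literature.MathematicalPhysics.QuantumFieldTheory.Balaban1983to89.LatticeFieldCalculus (bondAvg segSum)
open Literature.MathematicalPhysics.QuantumFieldTheory.Balaban1983to89.B12RegularSpaces111 (expI gaugeU adJ plaq plaq_eq nabla)
open Literature.MathematicalPhysics.QuantumFieldTheory.Balaban1983to89.MatrixLog (mlog)
open Literature.MathematicalPhysics.QuantumFieldTheory.Balaban1983to89.B7Prop1Explicit (l1 U1 mem_U1 treeWord)
open Literature.MathematicalPhysics.QuantumFieldTheory.Balaban1983to89.B10Eq27TorusAxialLog (holT rel axialT axialT_self)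
open Literature.MathematicalPhysics.QuantumFieldTheory.Balaban1983to89.T4TermwiseBCH (norm_units_conj_le)
open Literature.MathematicalPhysics.QuantumFieldTheory.Balaban1983to89.Node00.W1 (avgUnits)
open Summit.QuantumFields.YangMills.Theorems.Prop8Chart (emlAvgU_congr₂ norm_emlAvgU_sub_one_sub_linAvg_le)
open YMDAG.N18.AvgPotential (bondAvg_congr₂)
open YMDAG.N18.BoxStokes (two_mul_l1_le_of_inBox)

open Literature.MathematicalPhysics.QuantumFieldTheory.Balaban1983to89.BlockAveragingEMLLinearised (linAvg_eq_bondAvg_sub_grad_combMean)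
open Literature.MathematicalPhysics.QuantumFieldTheory.Balaban1983to89.B12RegularSpaces111Mono (expI_zero)
open YMDAG.N18.AvgPotential (combMean_congr_block)

variable {P : Params} {j : ℕ} {n : Type*} [Fintype n] [DecidableEq n] [Nonempty n]

/-- ★ **THE BASE CHANGE OF THE TRANSPORTED COMB** ((4c)'s internal letter, exposed): at a coarse bond `c` with two-block hypotheses (`U ∈ U1`, plaquettes `≤ α`,
`((d+2)L∕2)α ≤ t`, `48ℓt ≤ 1`, `|A′| ≤ a` on the block of `c₊`), with `U_A = Ū(U)`, `m(c₊) = λ̄_{Ad(axialT U (emb c₊))A′}(c₊)` and `v = axialT U (emb c₋)`: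
`‖U_A(c)·m(c₊)·U_A(c)⁻¹ − λ̄_{Ad(v)A′}(c₊)‖ ≤ 69ℓ²·t·a` (`U_A(c) = E·v(emb c₊)`, `‖E − 1‖ ≤ 17ℓt`, (2a) ★ `norm_combMean_sub_conj_combMean_le`).
[cite: Balaban1985Averaging, (62)-(63) p.28, pp.24-25, Prop. 3 p.36; Balaban1987RG1, (0.4) p.253, (1.12) p.262] -/
theorem norm_transported_comb_sub_combMean_le (hj : j + 1 ≤ P.m + P.K) (hj2 : j + 2 ≤ P.m + P.K) (c : PBond P (j + 1))
    {U : GaugeField P j (Matrix n n ℂ)ˣ} {A : PBond P j → Matrix n n ℂ} {a α t : ℝ} (ha0 : 0 ≤ a) (hα : 0 ≤ α)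
    (hA : ∀ b : PBond P j, (blockOf b.src = c.src ∨ blockOf b.src = c.tgt) → (blockOf b.tgt = c.src ∨ blockOf b.tgt = c.tgt) → ‖A b‖ ≤ a)
    (hU1 : ∀ b : PBond P j, (blockOf b.src = c.src ∨ blockOf b.src = c.tgt) → (blockOf b.tgt = c.src ∨ blockOf b.tgt = c.tgt) →
      U b ∈ U1 (Matrix n n ℂ))
    (hplaq : ∀ p : Plaq P j, (blockOf p.src = c.src ∨ blockOf p.src = c.tgt) →
      (blockOf (p.src.shift p.μ) = c.src ∨ blockOf (p.src.shift p.μ) = c.tgt) →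
      (blockOf (p.src.shift p.ν) = c.src ∨ blockOf (p.src.shift p.ν) = c.tgt) →
      (blockOf ((p.src.shift p.μ).shift p.ν) = c.src ∨ blockOf ((p.src.shift p.μ).shift p.ν) = c.tgt) →
      ‖((plaq U p : (Matrix n n ℂ)ˣ) : Matrix n n ℂ) - 1‖ ≤ α)
    (hRt : ((((P.d + 2) * P.L : ℕ) : ℝ) / 2) * α ≤ t) (hℓt : 48 * (((P.d + 2) * P.L : ℕ) : ℝ) * t ≤ 1) :
    ‖((avgUnits U c : (Matrix n n ℂ)ˣ) : Matrix n n ℂ) * combMean (adJ (axialT U (emb c.tgt)) A) c.tgt * (((avgUnits U c)⁻¹ : (Matrix n n ℂ)ˣ) : Matrix n n ℂ) -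
        combMean (adJ (axialT U (emb c.src)) A) c.tgt‖ ≤ 69 * (((P.d + 2) * P.L : ℕ) : ℝ) ^ 2 * t * a := by
  classical
  have ht0 : 0 ≤ t := le_trans (by positivity) hRt
  -- the two-block predicate (blocks) and the box predicate (relative positions); the former implies the latter
  let χ : PBond P j → Prop := fun b => (blockOf b.src = c.src ∨ blockOf b.src = c.tgt) ∧ (blockOf b.tgt = c.src ∨ blockOf b.tgt = c.tgt)
  -- the cut-off fields (before gauging): globally `U1`, factorised everywhere
  let U' : GaugeField P j (Matrix n n ℂ)ˣ := fun b => if χ b then U b else 1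
  have hU'U : ∀ b : PBond P j, (blockOf b.src = c.src ∨ blockOf b.src = c.tgt) → (blockOf b.tgt = c.src ∨ blockOf b.tgt = c.tgt) → U' b = U b :=
    fun b h1 h2 => by simp only [U', χ, if_pos (And.intro h1 h2)]
  have hUU' : ∀ b : PBond P j, (blockOf b.src = c.src ∨ blockOf b.src = c.tgt) → (blockOf b.tgt = c.src ∨ blockOf b.tgt = c.tgt) → U b = U' b :=
    fun b h1 h2 => (hU'U b h1 h2).symm
  have hU'1 : ∀ b, U' b ∈ U1 (Matrix n n ℂ) := fun b => by
    by_cases hb : χ b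
    · simp only [U', if_pos hb]; exact hU1 b hb.1 hb.2
    · simp only [U', if_neg hb]; exact (U1 _).one_mem
  have hplaq' : ∀ p : Plaq P j, (blockOf p.src = c.src ∨ blockOf p.src = c.tgt) →
      (blockOf (p.src.shift p.μ) = c.src ∨ blockOf (p.src.shift p.μ) = c.tgt) →
      (blockOf (p.src.shift p.ν) = c.src ∨ blockOf (p.src.shift p.ν) = c.tgt) →
      (blockOf ((p.src.shift p.μ).shift p.ν) = c.src ∨ blockOf ((p.src.shift p.μ).shift p.ν) = c.tgt) →
      ‖((plaq U' p : (Matrix n n ℂ)ˣ) : Matrix n n ℂ) - 1‖ ≤ α := fun p c1 c2 c3 c4 => by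
    have hpe : plaq U' p = plaq U p := by
      rw [plaq_eq, plaq_eq, hU'U ⟨p.src, p.μ⟩ c1 c2, hU'U ⟨p.src.shift p.μ, p.ν⟩ c2 c4, hU'U ⟨p.src, p.ν⟩ c1 c3,
        hU'U ⟨p.src.shift p.ν, p.μ⟩ c3 (by rw [PBond.tgt, Site.shift_comm]; exact c4)]
    rw [hpe]; exact hplaq p c1 c2 c3 c4
  -- the axial gauge of the cut-off factor: globally `U1`, `= 1` at the centre, `= axialT U (emb c₋)` on the two blocks
  set v : Site P j → (Matrix n n ℂ)ˣ := axialT U' (emb c.src) with hvdef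
  have hv1 : ∀ x, v x ∈ U1 (Matrix n n ℂ) := fun x => axialT_mem_U1 hU'1 _ x
  have hv0 : v (emb c.src) = 1 := axialT_self U' (emb c.src)
  have hvU : ∀ x : Site P j, (blockOf x = c.src ∨ blockOf x = c.tgt) → v x = axialT U (emb c.src) x := fun x hx =>
    axialT_congr_of_twoBlock hj hj2 c hU'U hx
  set v₀ : Site P j → (Matrix n n ℂ)ˣ := axialT U (emb c.src) with hv₀
  -- the base change at `c₊` (file (2a) ★ + the `E`-conjugation of (2b)): `‖U_A m₊ U_A⁻¹ − λ̄₊‖ ≤ 69ℓ²ta`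
  set ℓ : ℝ := (((P.d + 2) * P.L : ℕ) : ℝ) with hℓdef
  have hℓ0 : 0 ≤ ℓ := Nat.cast_nonneg _
  have hℓ1 : 1 ≤ ℓ := by
    rw [hℓdef]; have := P.L_pos; have : 1 ≤ (P.d + 2) * P.L := Nat.one_le_iff_ne_zero.mpr (by positivity); exact_mod_cast this
  have h2 := norm_combMean_sub_conj_combMean_le hj hj2 c ha0 hα (fun b h1 h2 => hA b (Or.inr h1) (Or.inr h2)) hU1 hplaq hRt
  set g : (Matrix n n ℂ)ˣ := v₀ (emb c.tgt) with hg
  set mt : Matrix n n ℂ := combMean (adJ (axialT U (emb c.tgt)) A) c.tgt with hmt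
  set lt : Matrix n n ℂ := combMean (adJ v₀ A) c.tgt with hlt
  set ls : Matrix n n ℂ := combMean (adJ v₀ A) c.src with hls
  set UA : (Matrix n n ℂ)ˣ := avgUnits U c with hUA
  have hV₀ : ∀ b : PBond P j, (blockOf b.src = c.src ∨ blockOf b.src = c.tgt) → (blockOf b.tgt = c.src ∨ blockOf b.tgt = c.tgt) →
      ‖((gaugeU v U' b : (Matrix n n ℂ)ˣ) : Matrix n n ℂ) - 1‖ ≤ t := fun b h1 h2 =>
    (norm_gaugeU_axialT_sub_one_le_of_twoBlock hj hj2 hU'1 c hα hplaq' b h1 h2).trans hRt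
  have h17 := (norm_emlAvgU_sub_one_sub_linAvg_le hj (S := gaugeU v U') c ht0 hℓt hV₀).2
  set E : (Matrix n n ℂ)ˣ := avgUnits (gaugeU v U') c with hE
  change ‖(E : Matrix n n ℂ) - 1‖ ≤ 17 * ℓ * t at h17
  have hUA_eq : UA = E * g := by
    have hcov := avgUnits_gaugeU v U'
    have hloc : avgUnits U' c = avgUnits U c := emlAvgU_congr₂ hj c hU'U
    have hE' : E = v (emb c.src) * avgUnits U c * (v (emb c.tgt))⁻¹ := by
      rw [hE, hcov]; simp only [gaugeU, hloc]
    rw [hE', hv0, one_mul, hUA, hg, ← hvU _ (Or.inr (Site.blockOf_emb hj c.tgt)), inv_mul_cancel_right]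
  have hmt' : ‖mt‖ ≤ ℓ * a := by
    let Yb : PBond P j → Matrix n n ℂ := fun b => if blockOf b.src = c.tgt ∧ blockOf b.tgt = c.tgt then adJ (axialT U (emb c.tgt)) A b else 0
    have hY : ∀ b, ‖Yb b‖ ≤ a := fun b => by
      by_cases hb : blockOf b.src = c.tgt ∧ blockOf b.tgt = c.tgt
      · simp only [Yb, if_pos hb, adJ]
        have hu1 : axialT U (emb c.tgt) b.src ∈ U1 (Matrix n n ℂ) := by
          rw [axialT_congr_of_block hj (fun b' h1 h2 => (hU'U b' (Or.inr h1) (Or.inr h2)).symm) hb.1]; exact axialT_mem_U1 hU'1 _ _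
        exact (norm_units_conj_le hu1 _).trans (hA b (Or.inr hb.1) (Or.inr hb.2))
      · simp only [Yb, if_neg hb, norm_zero]; exact ha0
    have hmY : mt = combMean Yb c.tgt := combMean_congr_block hj c.tgt fun b h1 h2 => by simp only [Yb, if_pos (And.intro h1 h2)]
    rw [hmY]; exact norm_combMean_le_of_bound Yb ha0 hY c.tgt
  have hg1 : g ∈ U1 (Matrix n n ℂ) := by rw [hg, ← hvU _ (Or.inr (Site.blockOf_emb hj c.tgt))]; exact hv1 _
  have hY' : ‖(g : Matrix n n ℂ) * mt * ((g⁻¹ : (Matrix n n ℂ)ˣ) : Matrix n n ℂ)‖ ≤ ℓ * a := (norm_units_conj_le hg1 _).trans hmt'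
  have hconjE : ‖(UA : Matrix n n ℂ) * mt * ((UA⁻¹ : (Matrix n n ℂ)ˣ) : Matrix n n ℂ) - (g : Matrix n n ℂ) * mt * ((g⁻¹ : (Matrix n n ℂ)ˣ) : Matrix n n ℂ)‖ ≤
      4 * (17 * ℓ * t) * (ℓ * a) := by
    have hid : (UA : Matrix n n ℂ) * mt * ((UA⁻¹ : (Matrix n n ℂ)ˣ) : Matrix n n ℂ) =
        (E : Matrix n n ℂ) * ((g : Matrix n n ℂ) * mt * ((g⁻¹ : (Matrix n n ℂ)ˣ) : Matrix n n ℂ)) * ((E⁻¹ : (Matrix n n ℂ)ˣ) : Matrix n n ℂ) := by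
      rw [hUA_eq, mul_inv_rev, Units.val_mul, Units.val_mul]; noncomm_ring
    rw [hid]
    exact (norm_conj_sub_le_of_near_one h17 (by nlinarith only [hℓt, hℓ0, ht0]) _).trans (mul_le_mul_of_nonneg_left hY' (by positivity))
  have hBC : ‖(UA : Matrix n n ℂ) * mt * ((UA⁻¹ : (Matrix n n ℂ)ˣ) : Matrix n n ℂ) - lt‖ ≤ 69 * ℓ ^ 2 * t * a := by
    have h2' : ‖lt - (g : Matrix n n ℂ) * mt * ((g⁻¹ : (Matrix n n ℂ)ˣ) : Matrix n n ℂ)‖ ≤ ℓ ^ 2 * t * a := h2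
    have hsplit : (UA : Matrix n n ℂ) * mt * ((UA⁻¹ : (Matrix n n ℂ)ˣ) : Matrix n n ℂ) - lt =
        ((UA : Matrix n n ℂ) * mt * ((UA⁻¹ : (Matrix n n ℂ)ˣ) : Matrix n n ℂ) - (g : Matrix n n ℂ) * mt * ((g⁻¹ : (Matrix n n ℂ)ˣ) : Matrix n n ℂ)) -
          (lt - (g : Matrix n n ℂ) * mt * ((g⁻¹ : (Matrix n n ℂ)ˣ) : Matrix n n ℂ)) := by abel
    rw [hsplit]
    refine (norm_sub_le _ _).trans ?_
    nlinarith [hconjE, h2', mul_nonneg (mul_nonneg hℓ0 ht0) ha0]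
  exact hBC


/-- ★ **THE MAIN BLOCK OF THE C¹ CANCELLED SUM** ((4d)'s internal letter, exposed): under (4d)'s pair-block hypotheses, with `M(d) = (η∕ξ)·L·Q(Ad(axialT U (emb d₋))A′)(d)`,
`‖Ū(U)(y,ν)·M(c′)·Ū(U)(y,ν)⁻¹ − M(c)‖ ≤ (η∕ξ)·L·(69ℓ·t·a + L·(η·a₁ + 2t·a))` (`Ū(U)(y,ν) = E_ν·v′`, the base change `H`, (4b)'s main term).
[cite: Balaban1985Averaging, Prop. 3 (122)-(126) p.36, (62)-(63) p.28, pp.24-25; Balaban1984PropagatorsI, (1.11) p.19; Balaban1987RG1, (0.4) p.253, (1.10)-(1.13) p.262] -/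
theorem norm_transported_main_sub_main_le (hj : j + 1 ≤ P.m + P.K) (hj2 : j + 2 ≤ P.m + P.K) (y : Site P (j + 1)) (μ ν : Fin P.d)
    {U : GaugeField P j (Matrix n n ℂ)ˣ} {A : PBond P j → Matrix n n ℂ} {η ξ a a₁ α t : ℝ} (hη : 0 < η) (hξ : 0 < ξ) (ha0 : 0 ≤ a) (ha1 : 0 ≤ a₁)
    (hα : 0 ≤ α)
    (hA : ∀ b : PBond P j, (blockOf b.src = y ∨ blockOf b.src = y.shift μ ∨ blockOf b.src = y.shift ν ∨ blockOf b.src = (y.shift μ).shift ν) →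
      (blockOf b.tgt = y ∨ blockOf b.tgt = y.shift μ ∨ blockOf b.tgt = y.shift ν ∨ blockOf b.tgt = (y.shift μ).shift ν) → ‖A b‖ ≤ a)
    (hU1 : ∀ b : PBond P j, (blockOf b.src = y ∨ blockOf b.src = y.shift μ ∨ blockOf b.src = y.shift ν ∨ blockOf b.src = (y.shift μ).shift ν) →
      (blockOf b.tgt = y ∨ blockOf b.tgt = y.shift μ ∨ blockOf b.tgt = y.shift ν ∨ blockOf b.tgt = (y.shift μ).shift ν) → U b ∈ U1 (Matrix n n ℂ))
    (hplaq : ∀ p : Plaq P j, (blockOf p.src = y ∨ blockOf p.src = y.shift μ ∨ blockOf p.src = y.shift ν ∨ blockOf p.src = (y.shift μ).shift ν) →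
      (blockOf (p.src.shift p.μ) = y ∨ blockOf (p.src.shift p.μ) = y.shift μ ∨ blockOf (p.src.shift p.μ) = y.shift ν ∨
        blockOf (p.src.shift p.μ) = (y.shift μ).shift ν) →
      (blockOf (p.src.shift p.ν) = y ∨ blockOf (p.src.shift p.ν) = y.shift μ ∨ blockOf (p.src.shift p.ν) = y.shift ν ∨
        blockOf (p.src.shift p.ν) = (y.shift μ).shift ν) →
      (blockOf ((p.src.shift p.μ).shift p.ν) = y ∨ blockOf ((p.src.shift p.μ).shift p.ν) = y.shift μ ∨
        blockOf ((p.src.shift p.μ).shift p.ν) = y.shift ν ∨ blockOf ((p.src.shift p.μ).shift p.ν) = (y.shift μ).shift ν) →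
      ‖((plaq U p : (Matrix n n ℂ)ˣ) : Matrix n n ℂ) - 1‖ ≤ α)
    (hA1 : ∀ (z : Site P j) (κ : Fin P.d),
      (blockOf z = y ∨ blockOf z = y.shift μ ∨ blockOf z = y.shift ν ∨ blockOf z = (y.shift μ).shift ν) →
      (blockOf (z.shift ν) = y ∨ blockOf (z.shift ν) = y.shift μ ∨ blockOf (z.shift ν) = y.shift ν ∨ blockOf (z.shift ν) = (y.shift μ).shift ν) →
      (blockOf (z.shift κ) = y ∨ blockOf (z.shift κ) = y.shift μ ∨ blockOf (z.shift κ) = y.shift ν ∨ blockOf (z.shift κ) = (y.shift μ).shift ν) →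
      (blockOf ((z.shift ν).shift κ) = y ∨ blockOf ((z.shift ν).shift κ) = y.shift μ ∨ blockOf ((z.shift ν).shift κ) = y.shift ν ∨
        blockOf ((z.shift ν).shift κ) = (y.shift μ).shift ν) →
      ‖nabla η U ν (fun w => A ⟨w, κ⟩) z‖ ≤ a₁)
    (hRt : ((((P.d + 4) * P.L : ℕ) : ℝ) / 2) * α ≤ t)
    (hℓt : 136 * (((P.d + 2) * P.L : ℕ) : ℝ) * t ≤ 1) :
    ‖((avgUnits U ⟨y, ν⟩ : (Matrix n n ℂ)ˣ) : Matrix n n ℂ) *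
          (((η / ξ : ℝ) : ℂ) • (((P.L : ℕ) : ℂ) • bondAvg (adJ (axialT U (emb (y.shift ν))) A) (⟨y.shift ν, μ⟩ : PBond P (j + 1)))) *
          (((avgUnits U ⟨y, ν⟩)⁻¹ : (Matrix n n ℂ)ˣ) : Matrix n n ℂ) -
        ((η / ξ : ℝ) : ℂ) • (((P.L : ℕ) : ℂ) • bondAvg (adJ (axialT U (emb y)) A) (⟨y, μ⟩ : PBond P (j + 1)))‖ ≤
      η / ξ * (P.L : ℝ) * (69 * (((P.d + 2) * P.L : ℕ) : ℝ) * t * a + (P.L : ℝ) * (η * a₁ + 2 * t * a)) := by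
  classical
  have ht0 : 0 ≤ t := le_trans (by positivity) hRt
  set ℓ : ℝ := (((P.d + 2) * P.L : ℕ) : ℝ) with hℓdef
  have hℓ0 : 0 ≤ ℓ := Nat.cast_nonneg _
  have hℓ1 : 1 ≤ ℓ := by
    rw [hℓdef]; have := P.L_pos; have : 1 ≤ (P.d + 2) * P.L := Nat.one_le_iff_ne_zero.mpr (by positivity); exact_mod_cast this
  have hRt2 : ((((P.d + 2) * P.L : ℕ) : ℝ) / 2) * α ≤ t := by
    refine le_trans (mul_le_mul_of_nonneg_right ?_ hα) hRt
    gcongr; omega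
  -- names
  have hνμ : (y.shift ν).shift μ = (y.shift μ).shift ν := Site.shift_comm _ _ _
  -- membership maps: two blocks of `(⟨y, μ⟩ : PBond P (j + 1))`, of `(⟨y, μ⟩ : PBond P (j + 1))′`, of `⟨y, ν⟩` into the pair blocks
  have incC : ∀ x : Site P j, (blockOf x = y ∨ blockOf x = (y.shift μ)) →
      (blockOf x = y ∨ blockOf x = y.shift μ ∨ blockOf x = y.shift ν ∨ blockOf x = (y.shift μ).shift ν) := fun x h => by
    rcases h with h | h
    · exact Or.inl h
    · exact Or.inr (Or.inl h)
  have incC' : ∀ x : Site P j, (blockOf x = (y.shift ν) ∨ blockOf x = ((y.shift ν).shift μ)) →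
      (blockOf x = y ∨ blockOf x = y.shift μ ∨ blockOf x = y.shift ν ∨ blockOf x = (y.shift μ).shift ν) := fun x h => by
    rcases h with h | h
    · exact Or.inr (Or.inr (Or.inl h))
    · refine Or.inr (Or.inr (Or.inr ?_)); rw [← hνμ]; exact h
  have incN : ∀ x : Site P j, (blockOf x = (⟨y, ν⟩ : PBond P (j + 1)).src ∨ blockOf x = (⟨y, ν⟩ : PBond P (j + 1)).tgt) →
      (blockOf x = y ∨ blockOf x = y.shift μ ∨ blockOf x = y.shift ν ∨ blockOf x = (y.shift μ).shift ν) := fun x h => by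
    rcases h with h | h
    · exact Or.inl h
    · exact Or.inr (Or.inr (Or.inl h))
  -- the main term (4b)
  have hMT := norm_bondAvg_adJ_axialT_shift_sub_le hj hj2 y μ ν (U := U) (A := A) hη ha0 ha1 hα hU1 hplaq hA hA1 hRt
  -- the pair-box cut-off: `(axialT U (emb y))` on the pair blocks, `U^{(axialT U (emb y))}` within `t` there, the cut-off-after-gauging field `W₀`
  let χ : PBond P j → Prop := fun b =>
    (blockOf b.src = y ∨ blockOf b.src = y.shift μ ∨ blockOf b.src = y.shift ν ∨ blockOf b.src = (y.shift μ).shift ν) ∧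
    (blockOf b.tgt = y ∨ blockOf b.tgt = y.shift μ ∨ blockOf b.tgt = y.shift ν ∨ blockOf b.tgt = (y.shift μ).shift ν)
  let U' : GaugeField P j (Matrix n n ℂ)ˣ := fun b => if χ b then U b else 1
  have hU'U : ∀ b : PBond P j, (blockOf b.src = y ∨ blockOf b.src = y.shift μ ∨ blockOf b.src = y.shift ν ∨ blockOf b.src = (y.shift μ).shift ν) →
      (blockOf b.tgt = y ∨ blockOf b.tgt = y.shift μ ∨ blockOf b.tgt = y.shift ν ∨ blockOf b.tgt = (y.shift μ).shift ν) → U' b = U b :=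
    fun b h1 h2 => by simp only [U', χ, if_pos (And.intro h1 h2)]
  have hU'1 : ∀ b, U' b ∈ U1 (Matrix n n ℂ) := fun b => by
    by_cases hb : χ b
    · simp only [U', if_pos hb]; exact hU1 b hb.1 hb.2
    · simp only [U', if_neg hb]; exact (U1 _).one_mem
  have hplaq' : ∀ p : Plaq P j, (blockOf p.src = y ∨ blockOf p.src = y.shift μ ∨ blockOf p.src = y.shift ν ∨ blockOf p.src = (y.shift μ).shift ν) →
      (blockOf (p.src.shift p.μ) = y ∨ blockOf (p.src.shift p.μ) = y.shift μ ∨ blockOf (p.src.shift p.μ) = y.shift ν ∨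
        blockOf (p.src.shift p.μ) = (y.shift μ).shift ν) →
      (blockOf (p.src.shift p.ν) = y ∨ blockOf (p.src.shift p.ν) = y.shift μ ∨ blockOf (p.src.shift p.ν) = y.shift ν ∨
        blockOf (p.src.shift p.ν) = (y.shift μ).shift ν) →
      (blockOf ((p.src.shift p.μ).shift p.ν) = y ∨ blockOf ((p.src.shift p.μ).shift p.ν) = y.shift μ ∨
        blockOf ((p.src.shift p.μ).shift p.ν) = y.shift ν ∨ blockOf ((p.src.shift p.μ).shift p.ν) = (y.shift μ).shift ν) →
      ‖((plaq U' p : (Matrix n n ℂ)ˣ) : Matrix n n ℂ) - 1‖ ≤ α := fun p c1 c2 c3 c4 => by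
    have hpe : plaq U' p = plaq U p := by
      rw [plaq_eq, plaq_eq, hU'U ⟨p.src, p.μ⟩ c1 c2, hU'U ⟨p.src.shift p.μ, p.ν⟩ c2 c4, hU'U ⟨p.src, p.ν⟩ c1 c3,
        hU'U ⟨p.src.shift p.ν, p.μ⟩ c3 (by rw [PBond.tgt, Site.shift_comm]; exact c4)]
    rw [hpe]; exact hplaq p c1 c2 c3 c4
  have hvv' : ∀ x : Site P j, (blockOf x = y ∨ blockOf x = y.shift μ ∨ blockOf x = y.shift ν ∨ blockOf x = (y.shift μ).shift ν) →
      (axialT U (emb y)) x = axialT U' (emb y) x := fun x hx => (axialT_congr_of_pairBlocks hj hj2 y μ ν hU'U hx).symm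
  have hv1 : ∀ x : Site P j, (blockOf x = y ∨ blockOf x = y.shift μ ∨ blockOf x = y.shift ν ∨ blockOf x = (y.shift μ).shift ν) →
      (axialT U (emb y)) x ∈ U1 (Matrix n n ℂ) := fun x hx => by rw [hvv' x hx]; exact axialT_mem_U1 hU'1 _ x
  have hV₀ : ∀ b : PBond P j, (blockOf b.src = y ∨ blockOf b.src = y.shift μ ∨ blockOf b.src = y.shift ν ∨ blockOf b.src = (y.shift μ).shift ν) →
      (blockOf b.tgt = y ∨ blockOf b.tgt = y.shift μ ∨ blockOf b.tgt = y.shift ν ∨ blockOf b.tgt = (y.shift μ).shift ν) →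
      gaugeU (axialT U (emb y)) U b ∈ U1 (Matrix n n ℂ) ∧ ‖((gaugeU (axialT U (emb y)) U b : (Matrix n n ℂ)ˣ) : Matrix n n ℂ) - 1‖ ≤ t := fun b h1 h2 => by
    have heq : gaugeU (axialT U (emb y)) U b = gaugeU (axialT U' (emb y)) U' b := by
      simp only [gaugeU, hvv' b.src h1, hvv' b.tgt h2, hU'U b h1 h2]
    rw [heq]
    refine ⟨(U1 _).mul_mem ((U1 _).mul_mem (axialT_mem_U1 hU'1 _ _) (hU'1 b)) ((U1 _).inv_mem (axialT_mem_U1 hU'1 _ _)), ?_⟩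
    exact (norm_gaugeU_axialT_sub_one_le_of_pairBlocks hj hj2 hU'1 y μ ν hα hplaq' b h1 h2).trans hRt
  let W₀ : GaugeField P j (Matrix n n ℂ)ˣ := fun b => if χ b then gaugeU (axialT U (emb y)) U b else 1
  have hW₀1 : ∀ b, W₀ b ∈ U1 (Matrix n n ℂ) := fun b => by
    by_cases hb : χ b
    · simp only [W₀, if_pos hb]; exact (hV₀ b hb.1 hb.2).1
    · simp only [W₀, if_neg hb]; exact (U1 _).one_mem
  have hW₀t : ∀ b, ‖((W₀ b : (Matrix n n ℂ)ˣ) : Matrix n n ℂ) - 1‖ ≤ t := fun b => by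
    by_cases hb : χ b
    · simp only [W₀, if_pos hb]; exact (hV₀ b hb.1 hb.2).2
    · simp only [W₀, if_neg hb, Units.val_one, sub_self, norm_zero]; exact ht0
  -- `Ū(U)(y,ν) = E_ν·(axialT U (emb y) (emb (y.shift ν)))` with `(axialT U (emb y) (emb (y.shift ν))) = (axialT U (emb y))(emb(y + e_ν))`, `‖E_ν − 1‖ ≤ 17ℓt` (two-block locality for the bond `⟨y, ν⟩`)
  have hctr' : blockOf (emb (y.shift ν)) = y.shift ν := Site.blockOf_emb hj _
  have hg1 : (axialT U (emb y) (emb (y.shift ν))) ∈ U1 (Matrix n n ℂ) := hv1 _ (Or.inr (Or.inr (Or.inl hctr')))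
  let Uν : GaugeField P j (Matrix n n ℂ)ˣ := fun b =>
    if (blockOf b.src = y ∨ blockOf b.src = y.shift ν) ∧ (blockOf b.tgt = y ∨ blockOf b.tgt = y.shift ν) then U b else 1
  have hUνU : ∀ b : PBond P j, (blockOf b.src = (⟨y, ν⟩ : PBond P (j + 1)).src ∨ blockOf b.src = (⟨y, ν⟩ : PBond P (j + 1)).tgt) →
      (blockOf b.tgt = (⟨y, ν⟩ : PBond P (j + 1)).src ∨ blockOf b.tgt = (⟨y, ν⟩ : PBond P (j + 1)).tgt) → Uν b = U b := fun b h1 h2 => by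
    have hb : (blockOf b.src = y ∨ blockOf b.src = y.shift ν) ∧ (blockOf b.tgt = y ∨ blockOf b.tgt = y.shift ν) := ⟨h1, h2⟩
    simp only [Uν, if_pos hb]
  have hUν1 : ∀ b, Uν b ∈ U1 (Matrix n n ℂ) := fun b => by
    by_cases hb : (blockOf b.src = y ∨ blockOf b.src = y.shift ν) ∧ (blockOf b.tgt = y ∨ blockOf b.tgt = y.shift ν)
    · simp only [Uν, if_pos hb]; exact hU1 b (incN _ hb.1) (incN _ hb.2)
    · simp only [Uν, if_neg hb]; exact (U1 _).one_mem
  have hvν : ∀ x : Site P j, (blockOf x = (⟨y, ν⟩ : PBond P (j + 1)).src ∨ blockOf x = (⟨y, ν⟩ : PBond P (j + 1)).tgt) →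
      (axialT U (emb y)) x = axialT Uν (emb y) x := fun x hx => (axialT_congr_of_twoBlock hj hj2 ⟨y, ν⟩ hUνU hx).symm
  have hVν : ∀ b : PBond P j, (blockOf b.src = (⟨y, ν⟩ : PBond P (j + 1)).src ∨ blockOf b.src = (⟨y, ν⟩ : PBond P (j + 1)).tgt) →
      (blockOf b.tgt = (⟨y, ν⟩ : PBond P (j + 1)).src ∨ blockOf b.tgt = (⟨y, ν⟩ : PBond P (j + 1)).tgt) →
      ‖((gaugeU (axialT Uν (emb y)) Uν b : (Matrix n n ℂ)ˣ) : Matrix n n ℂ) - 1‖ ≤ t := fun b h1 h2 => by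
    have heq : gaugeU (axialT Uν (emb y)) Uν b = gaugeU (axialT U (emb y)) U b := by
      simp only [gaugeU, hvν b.src h1, hvν b.tgt h2, hUνU b h1 h2]
    rw [heq]; exact (hV₀ b (incN _ h1) (incN _ h2)).2
  have h17 := (norm_emlAvgU_sub_one_sub_linAvg_le hj (S := gaugeU (axialT Uν (emb y)) Uν) ⟨y, ν⟩ ht0
    (by nlinarith only [hℓt, mul_nonneg hℓ0 ht0]) hVν).2
  set Eν : (Matrix n n ℂ)ˣ := avgUnits (gaugeU (axialT Uν (emb y)) Uν) ⟨y, ν⟩ with hEν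
  change ‖(Eν : Matrix n n ℂ) - 1‖ ≤ 17 * ℓ * t at h17
  have hUAν_eq : avgUnits U ⟨y, ν⟩ = Eν * (axialT U (emb y) (emb (y.shift ν))) := by
    have hcov := avgUnits_gaugeU (axialT Uν (emb y)) Uν
    have hloc : avgUnits Uν ⟨y, ν⟩ = avgUnits U ⟨y, ν⟩ := emlAvgU_congr₂ hj ⟨y, ν⟩ hUνU
    have hE' : Eν = axialT Uν (emb y) (emb y) * avgUnits U ⟨y, ν⟩ * (axialT Uν (emb y) (emb (y.shift ν)))⁻¹ := by
      rw [hEν, hcov]; simp only [gaugeU, hloc]; rfl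
    rw [hE', axialT_self, one_mul, hvν _ (Or.inr hctr'), inv_mul_cancel_right]
  -- the base change of the block means at `(⟨y, μ⟩ : PBond P (j + 1))′`: `(axialT U (emb y) (emb (y.shift ν)))·Q(Ad((axialT U (emb y))′)A)((⟨y, μ⟩ : PBond P (j + 1))′)·(axialT U (emb y) (emb (y.shift ν)))⁻¹` vs `Q(Ad((axialT U (emb y)))A)((⟨y, μ⟩ : PBond P (j + 1))′)`
  have hu'1 : ∀ x : Site P j, (blockOf x = (y.shift ν) ∨ blockOf x = ((y.shift ν).shift μ)) → (axialT U (emb (y.shift ν))) x ∈ U1 (Matrix n n ℂ) := fun x hx => by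
    rw [axialT_congr_of_twoBlock hj hj2 (⟨y.shift ν, μ⟩ : PBond P (j + 1)) (V' := U') (fun b h1 h2 => (hU'U b (incC' _ h1) (incC' _ h2)).symm) hx]
    exact axialT_mem_U1 hU'1 _ _
  have hQle : ‖(bondAvg (adJ (axialT U (emb (y.shift ν))) A) (⟨y.shift ν, μ⟩ : PBond P (j + 1)))‖ ≤ a := by
    let Yb : PBond P j → Matrix n n ℂ := fun b => if (blockOf b.src = (y.shift ν) ∨ blockOf b.src = ((y.shift ν).shift μ)) ∧ (blockOf b.tgt = (y.shift ν) ∨ blockOf b.tgt = ((y.shift ν).shift μ))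
      then adJ (axialT U (emb (y.shift ν))) A b else 0
    have hY : ∀ b, ‖Yb b‖ ≤ a := fun b => by
      by_cases hb : (blockOf b.src = (y.shift ν) ∨ blockOf b.src = ((y.shift ν).shift μ)) ∧ (blockOf b.tgt = (y.shift ν) ∨ blockOf b.tgt = ((y.shift ν).shift μ))
      · simp only [Yb, if_pos hb, adJ]
        exact (norm_units_conj_le (hu'1 b.src hb.1) _).trans (hA b (incC' _ hb.1) (incC' _ hb.2))
      · simp only [Yb, if_neg hb, norm_zero]; exact ha0
    have hQY : (bondAvg (adJ (axialT U (emb (y.shift ν))) A) (⟨y.shift ν, μ⟩ : PBond P (j + 1))) = bondAvg Yb (⟨y.shift ν, μ⟩ : PBond P (j + 1)) := bondAvg_congr₂ hj (⟨y.shift ν, μ⟩ : PBond P (j + 1)) fun b h1 h2 => by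
      have hb : (blockOf b.src = (y.shift ν) ∨ blockOf b.src = ((y.shift ν).shift μ)) ∧ (blockOf b.tgt = (y.shift ν) ∨ blockOf b.tgt = ((y.shift ν).shift μ)) := ⟨h1, h2⟩
      simp only [Yb, if_pos hb]
    rw [hQY]; exact norm_bondAvg_le_of_bound Yb hY (⟨y.shift ν, μ⟩ : PBond P (j + 1))
  -- `H_x = (axialT U (emb y) (emb (y.shift ν)))·(axialT U (emb y))′(x)·(axialT U (emb y))(x)⁻¹` is within `(ℓ/2)t` of `1` on the two blocks of `(⟨y, μ⟩ : PBond P (j + 1))′`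
  have hH : ∀ x : Site P j, (blockOf x = (y.shift ν) ∨ blockOf x = ((y.shift ν).shift μ)) →
      (axialT U (emb y) (emb (y.shift ν))) * (axialT U (emb (y.shift ν))) x * ((axialT U (emb y)) x)⁻¹ ∈ U1 (Matrix n n ℂ) ∧ ‖(((axialT U (emb y) (emb (y.shift ν))) * (axialT U (emb (y.shift ν))) x * ((axialT U (emb y)) x)⁻¹ : (Matrix n n ℂ)ˣ) : Matrix n n ℂ) - 1‖ ≤ ℓ / 2 * t := fun x hx => by
    refine ⟨(U1 _).mul_mem ((U1 _).mul_mem hg1 (hu'1 x hx)) ((U1 _).inv_mem (hv1 x (incC' _ hx))), ?_⟩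
    have hHeq : holT W₀ (emb (y.shift ν)) (treeWord (rel (emb (y.shift ν)) x)) = (axialT U (emb y) (emb (y.shift ν))) * (axialT U (emb (y.shift ν))) x * ((axialT U (emb y)) x)⁻¹ := by
      have hloc : holT W₀ (emb (y.shift ν)) (treeWord (rel (emb (y.shift ν)) x)) =
          holT (gaugeU (axialT U (emb y)) U) (emb (y.shift ν)) (treeWord (rel (emb (y.shift ν)) x)) := by
        have := axialT_congr_of_twoBlock hj hj2 (⟨y.shift ν, μ⟩ : PBond P (j + 1)) (V := W₀) (V' := gaugeU (axialT U (emb y)) U) (fun b h1 h2 => ?_) hx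
        · simpa only [axialT] using this
        have hb : χ b := ⟨incC' _ h1, incC' _ h2⟩
        simp only [W₀, if_pos hb]
      rw [hloc, holT_gaugeU_treeWord_eq]
    rw [← hHeq]
    refine (norm_holT_sub_one_le_length_mul hW₀1 ht0 hW₀t _ _).trans ?_
    rw [B7Prop1Explicit.length_treeWord]
    have hin := inBox_rel_of_twoBlock hj hj2 (⟨y.shift ν, μ⟩ : PBond P (j + 1)) hx
    have h2l : (2 : ℝ) * ((l1 (rel (emb (y.shift ν)) x) : ℕ) : ℝ) ≤ ℓ := by
      rw [hℓdef]; exact_mod_cast two_mul_l1_le_of_inBox (⟨y.shift ν, μ⟩ : PBond P (j + 1)) (fun κ => hin κ)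
    nlinarith only [h2l, ht0]
  have hBC' : ‖(((axialT U (emb y) (emb (y.shift ν))) : (Matrix n n ℂ)ˣ) : Matrix n n ℂ) * (bondAvg (adJ (axialT U (emb (y.shift ν))) A) (⟨y.shift ν, μ⟩ : PBond P (j + 1))) * (((axialT U (emb y) (emb (y.shift ν)))⁻¹ : (Matrix n n ℂ)ˣ) : Matrix n n ℂ) - (bondAvg (adJ (axialT U (emb y)) A) (⟨y.shift ν, μ⟩ : PBond P (j + 1)))‖ ≤ ℓ * t * a := by
    let D : PBond P j → Matrix n n ℂ := fun b => if (blockOf b.src = (y.shift ν) ∨ blockOf b.src = ((y.shift ν).shift μ)) ∧ (blockOf b.tgt = (y.shift ν) ∨ blockOf b.tgt = ((y.shift ν).shift μ))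
      then (((axialT U (emb y) (emb (y.shift ν))) : (Matrix n n ℂ)ˣ) : Matrix n n ℂ) * adJ (axialT U (emb (y.shift ν))) A b * (((axialT U (emb y) (emb (y.shift ν)))⁻¹ : (Matrix n n ℂ)ˣ) : Matrix n n ℂ) - adJ (axialT U (emb y)) A b else 0
    have hD : ∀ b, ‖D b‖ ≤ ℓ * t * a := fun b => by
      by_cases hb : (blockOf b.src = (y.shift ν) ∨ blockOf b.src = ((y.shift ν).shift μ)) ∧ (blockOf b.tgt = (y.shift ν) ∨ blockOf b.tgt = ((y.shift ν).shift μ))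
      · simp only [D, if_pos hb]
        set Hx : (Matrix n n ℂ)ˣ := (axialT U (emb y) (emb (y.shift ν))) * (axialT U (emb (y.shift ν))) b.src * ((axialT U (emb y)) b.src)⁻¹ with hHx
        have hgv : (axialT U (emb y) (emb (y.shift ν))) * (axialT U (emb (y.shift ν))) b.src = Hx * (axialT U (emb y)) b.src := by rw [hHx]; group
        have hid0 : (((axialT U (emb y) (emb (y.shift ν))) : (Matrix n n ℂ)ˣ) : Matrix n n ℂ) * adJ (axialT U (emb (y.shift ν))) A b * (((axialT U (emb y) (emb (y.shift ν)))⁻¹ : (Matrix n n ℂ)ˣ) : Matrix n n ℂ) =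
            (Hx : Matrix n n ℂ) * adJ (axialT U (emb y)) A b * ((Hx⁻¹ : (Matrix n n ℂ)ˣ) : Matrix n n ℂ) := by
          have e1 : (((axialT U (emb y) (emb (y.shift ν))) : (Matrix n n ℂ)ˣ) : Matrix n n ℂ) * adJ (axialT U (emb (y.shift ν))) A b * (((axialT U (emb y) (emb (y.shift ν)))⁻¹ : (Matrix n n ℂ)ˣ) : Matrix n n ℂ) =
              ((((axialT U (emb y) (emb (y.shift ν))) * (axialT U (emb (y.shift ν))) b.src : (Matrix n n ℂ)ˣ)) : Matrix n n ℂ) * A b * (((((axialT U (emb y) (emb (y.shift ν))) * (axialT U (emb (y.shift ν))) b.src)⁻¹ : (Matrix n n ℂ)ˣ)) : Matrix n n ℂ) := by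
            simp only [adJ, mul_inv_rev, Units.val_mul]; noncomm_ring
          have e2 : (Hx : Matrix n n ℂ) * adJ (axialT U (emb y)) A b * ((Hx⁻¹ : (Matrix n n ℂ)ˣ) : Matrix n n ℂ) =
              (((Hx * (axialT U (emb y)) b.src : (Matrix n n ℂ)ˣ)) : Matrix n n ℂ) * A b * ((((Hx * (axialT U (emb y)) b.src)⁻¹ : (Matrix n n ℂ)ˣ)) : Matrix n n ℂ) := by
            simp only [adJ, mul_inv_rev, Units.val_mul]; noncomm_ring
          rw [e1, e2, hgv]
        rw [hid0]
        obtain ⟨hHU, hHt⟩ := hH b.src hb.1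
        calc ‖(Hx : Matrix n n ℂ) * adJ (axialT U (emb y)) A b * ((Hx⁻¹ : (Matrix n n ℂ)ˣ) : Matrix n n ℂ) - adJ (axialT U (emb y)) A b‖ ≤ 2 * ‖(Hx : Matrix n n ℂ) - 1‖ * ‖adJ (axialT U (emb y)) A b‖ :=
              norm_conj_sub_le_of_U1 hHU _
          _ ≤ 2 * (ℓ / 2 * t) * a := by
              have hZ : ‖adJ (axialT U (emb y)) A b‖ ≤ a := (norm_units_conj_le (hv1 b.src (incC' _ hb.1)) _).trans (hA b (incC' _ hb.1) (incC' _ hb.2))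
              have : 0 ≤ ‖(Hx : Matrix n n ℂ) - 1‖ := norm_nonneg _
              nlinarith only [hZ, hHt, this, norm_nonneg (adJ (axialT U (emb y)) A b)]
          _ = ℓ * t * a := by ring
      · simp only [D, if_neg hb, norm_zero]; positivity
    have hdiff : (((axialT U (emb y) (emb (y.shift ν))) : (Matrix n n ℂ)ˣ) : Matrix n n ℂ) * (bondAvg (adJ (axialT U (emb (y.shift ν))) A) (⟨y.shift ν, μ⟩ : PBond P (j + 1))) * (((axialT U (emb y) (emb (y.shift ν)))⁻¹ : (Matrix n n ℂ)ˣ) : Matrix n n ℂ) - (bondAvg (adJ (axialT U (emb y)) A) (⟨y.shift ν, μ⟩ : PBond P (j + 1))) = bondAvg D (⟨y.shift ν, μ⟩ : PBond P (j + 1)) := by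
      rw [← bondAvg_units_conj]
      have hsub : bondAvg (fun b => (((axialT U (emb y) (emb (y.shift ν))) : (Matrix n n ℂ)ˣ) : Matrix n n ℂ) * adJ (axialT U (emb (y.shift ν))) A b * (((axialT U (emb y) (emb (y.shift ν)))⁻¹ : (Matrix n n ℂ)ˣ) : Matrix n n ℂ)) (⟨y.shift ν, μ⟩ : PBond P (j + 1)) - bondAvg (adJ (axialT U (emb y)) A) (⟨y.shift ν, μ⟩ : PBond P (j + 1)) =
          bondAvg (fun b => (((axialT U (emb y) (emb (y.shift ν))) : (Matrix n n ℂ)ˣ) : Matrix n n ℂ) * adJ (axialT U (emb (y.shift ν))) A b * (((axialT U (emb y) (emb (y.shift ν)))⁻¹ : (Matrix n n ℂ)ˣ) : Matrix n n ℂ) - adJ (axialT U (emb y)) A b) (⟨y.shift ν, μ⟩ : PBond P (j + 1)) := by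
        simp only [bondAvg, segSum, Finset.sum_sub_distrib, smul_sub]
      rw [hsub]
      refine bondAvg_congr₂ hj (⟨y.shift ν, μ⟩ : PBond P (j + 1)) fun b h1 h2 => ?_
      have hb : (blockOf b.src = (y.shift ν) ∨ blockOf b.src = ((y.shift ν).shift μ)) ∧ (blockOf b.tgt = (y.shift ν) ∨ blockOf b.tgt = ((y.shift ν).shift μ)) := ⟨h1, h2⟩
      simp only [D, if_pos hb]
    rw [hdiff]
    exact norm_bondAvg_le_of_bound D hD (⟨y.shift ν, μ⟩ : PBond P (j + 1))
  -- assemble the covariant difference quotient: `∇^ξ(W⟨·,μ⟩)(y) = ξ⁻¹·(U_A(y,ν)·W((⟨y, μ⟩ : PBond P (j + 1))′)·U_A(y,ν)⁻¹ − W((⟨y, μ⟩ : PBond P (j + 1))))`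
  have hmainQ := norm_conj_factor_sub_le hUAν_eq h17 (by nlinarith only [hℓt, mul_nonneg hℓ0 ht0]) hg1 (bondAvg (adJ (axialT U (emb (y.shift ν))) A) (⟨y.shift ν, μ⟩ : PBond P (j + 1))) (bondAvg (adJ (axialT U (emb y)) A) (⟨y.shift ν, μ⟩ : PBond P (j + 1))) (bondAvg (adJ (axialT U (emb y)) A) (⟨y, μ⟩ : PBond P (j + 1))) hQle hBC' hMT
  have hηξ : 0 ≤ η / ξ := div_nonneg hη.le hξ.le
  rw [conj_smul_smul_sub, norm_smul, norm_smul, Complex.norm_real, Complex.norm_natCast, Real.norm_of_nonneg hηξ, ← mul_assoc]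
  refine mul_le_mul_of_nonneg_left (hmainQ.trans (le_of_eq (by ring))) (by positivity)

end YMDAG.N18.TransportOfRecord

end
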